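import Summits.HodgeConjecture.HodgeConjecture.Theses.DerivedTorelliFermat

/-!
# Record of the dropped route item `DerivedTorelliFermat.K3Exhaustion` (stmt-HodgeConjecture-11121)

Route `HodgeConjecture/DerivedTorelliFermat` dropped its item `K3Exhaustion`
(stmt-HodgeConjecture-11121) after it was closed `refuted` (commit cab5fce94e33) by
`Summit.HodgeConjecture.HodgeConjecture.Theorems.DerivedTorelliFermatK3Exhaustion_refuted`
(`Theorems/DerivedTorelliFermatK3ExhaustionRefutation.lean`). The gate-written route file
`Theses/DerivedTorelliFermat.lean` therefore no longer declares the constant, while the refutation —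
a Theorems file, append-only, whose statement text `¬ …Theses.DerivedTorelliFermat.K3Exhaustion` may
not change — still names it ("Unknown identifier", full builds of 2026-08-16). This module
re-declares the constant under its ORIGINAL fully-qualified name with its ORIGINAL definiens (the
item's ledger signature, verbatim, in the route file's namespace and `open` context), so that the
refutation record elaborates again; it is imported by that file only (which sits at the 400-line
cap of Theorems files, hence the separate module). NOT a route item (no `route_item` attribute);
FALSE (see the refutation).
-/

namespace Summit.HodgeConjecture.HodgeConjecture.Theses.DerivedTorelliFermat

open scoped BigOperators Topology Manifold Classical MeasureTheory ProbabilityTheory Matrix InnerProductSpace ComplexConjugate ContinuousMap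
open Filter Set Function TopologicalSpace MeasureTheory

/-- **Record of the dropped route item `K3Exhaustion`** = stmt-HodgeConjecture-11121 (ledger
signature verbatim; NOT a route item; FALSE — `Theorems.DerivedTorelliFermatK3Exhaustion_refuted`):
for every degree `m`, each Hodge multiset of cardinality `6` in `ℤ/m` is claimed to be exhausted by
the listed K3/derived-Torelli mechanisms; refuted. Re-declared only so that the refutation record
keeps elaborating (see the module docstring). -/
def K3Exhaustion : Prop :=
  ∀ (m : ℕ) [NeZero m] (s : Multiset (ZMod m)), Literature.AlgebraicGeometry.HodgeTheory.FermatCharacter.IsHodgeMultiset s → Multiset.card s = 6 → (∃ (Q : Multiset (ZMod m)) (parts : Multiset (Multiset (ZMod m))), (∀ κ ∈ parts, (Literature.AlgebraicGeometry.HodgeTheory.FermatCharacter.IsHodgeMultiset κ ∧ Multiset.card κ ≤ 4) ∨ (Literature.AlgebraicGeometry.HodgeTheory.FermatCharacter.IsHodgeMultiset κ ∧ Literature.AlgebraicGeometry.HodgeTheory.FermatCharacter.IsSemiDecomposable κ) ∨ (5 ∣ m ∧ 5 < m ∧ ∃ a : ZMod m, Nat.Coprime a.val (m / 5) ∧ κ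 = {a, a + ((m / 5 : ℕ) : ZMod m), a + 2 * ((m / 5 : ℕ) : ZMod m), a + 3 * ((m / 5 : ℕ) : ZMod m), a + 4 * ((m / 5 : ℕ) : ZMod m), -(5 * a)})) ∧ s + (Q + Q.map fun a => -a) = parts.sum) ∨ (∃ β γ : Fin 4 → ZMod m, ((∀ i, β i ≠ 0) ∧ ∑ i, β i = 0 ∧ ∃! δ : Fin 4 → ZMod m, (∃ t : (ZMod m)ˣ, δ = fun i => (t : ZMod m) * β i) ∧ Literature.AlgebraicGeometry.HodgeTheory.FermatCharacter.normSum δ = m) ∧ β 3 + γ 3 = 0 ∧ s = ({β 0, β 1, β 2} + {γ 0, γ 1, γ 2} : Multiset (ZMod m)))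

end Summit.HodgeConjecture.HodgeConjecture.Theses.DerivedTorelliFermat
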